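import Mathlib
import Summits.Ventures.PercRepro2.LocRows
import Summits.Ventures.PercRepro2.SwRow
import Summits.Ventures.PercRepro2.SwOut
import Summits.Ventures.PercRepro2.SwAllRow
import Summits.Ventures.PercRepro2.SwOutAll
import Summits.Ventures.PercRepro2.SwOutArmFlip
import Summits.Ventures.PercRepro2.SwOutArmThm
import Summits.Ventures.PercRepro2.SwOutCoreDefs
import Summits.Ventures.PercRepro2.SwOutCoreHull
import Summits.Ventures.PercRepro2.SwOutCoreDual
import Summits.Ventures.PercRepro2.SwOutCoreKey
import Summits.Ventures.PercRepro2.SwOutShadowDefs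
import Summits.Ventures.PercRepro2.SwOutShadowCube
import Summits.Ventures.PercRepro2.SwOutShadowIneq
import Summits.Ventures.PercRepro2.SwOutCoreShadowDefs
import Summits.Ventures.PercRepro2.SwOutJunction
import Summits.Ventures.PercRepro2.SwOutJunctionRegion
import Summits.Ventures.PercRepro2.SwOutJunctionH1Defs
import Summits.Ventures.PercRepro2.SwOutJunctionH1Arms
import Summits.Ventures.PercRepro2.SwOutJunctionH1Cover
import Summits.Ventures.PercRepro2.SwOutJunctionH1Inside
import Summits.Ventures.PercRepro2.SwOutJunctionH1Base
import Summits.Ventures.PercRepro2.SwOutJunctionH1Kinds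
import Summits.Ventures.PercRepro2.SwOutCoreToggle
import Summits.Ventures.PercRepro2.SwOutCoreShadowArm
import Summits.Ventures.PercRepro2.SwOutCoreShadowKey
import Summits.Ventures.PercRepro2.SwOutCoreShadowUnion
import Summits.Ventures.PercRepro2.SwOutEdgeDefs
import Summits.Ventures.PercRepro2.SwOutEdgeHull
import Summits.Ventures.PercRepro2.SwOutEdgeDual
import Summits.Ventures.PercRepro2.SwOutEdgeBase
import Summits.Ventures.PercRepro2.SwOutEdgeKey
import Summits.Ventures.PercRepro2.SwOutEdgeShadow
import Summits.Ventures.PercRepro2.SwOutEdgeShadowFlip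
import Summits.Ventures.PercRepro2.SwOutEdgeToggle
import Summits.Ventures.PercRepro2.SwOutEdgeShadowArm
import Summits.Ventures.PercRepro2.SwOutEdgeShadowEsc
import Summits.Ventures.PercRepro2.SwOutEdgeShadowKey
import Summits.Ventures.PercRepro2.SwOutEdgeShadowUnion
import Summits.Ventures.PercRepro2.SwOutEdgeShadowKind
import Summits.Ventures.PercRepro2.SwOutEdgeShadowOrbit

/-!
# The kinds of the (H1) single junction adjacent to `h`: the orbits through a sealed point or a
shadow point (blind cell PercRepro2, night-4 g16, 2026-08-26; proofs/NIGHT4-G16.md §4)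

`SwOutJunctionH1Kinds` for the adjacent case (ONE h–u edge).  A `Q`-point of the class has `u` in
the hull of `h` (through the h–u edge) and is of the CORE KIND (the hull of `u` inside `U`), of
the SHADOW KIND (`ShadowKindE`) or ESCAPING OF THE PLAIN KIND.  A core-free e-cube point with `u`
in the hull is one-sided (`CoreBaseE.oneSided_of_coreFree`) and has a normalised one-sided point
(`exists_normalisedE`: the arm coordinates when red-one-sided — the h–u edge is then red — and
the toggled arm coordinates when blue-one-sided — the h–u edge is then blue).  THE TWO ORBIT
LEMMAS (`shadowKindE_of_mem_orbit_coreKind`, `shadowKindE_of_mem_orbit_shadowKind`) and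
`mem_orbit_plainE`, verbatim G14 on the e-chain.
-/

namespace Summit.Ventures.PercRepro2

namespace LocRows

open Hull

variable {V : Type*} {E : Type*} [Fintype E] [DecidableEq E]

open scoped Classical

variable {ends : E → Sym2 V} {U : Set V} {ξ : Config E} {l h o u : V}

section OneSided

variable {ι : Type*} {A : ι → Set V} {pure : ι → Prop} {b : Config E} {H : Set V}
  (hb : CoreBaseE ends b h u H A pure)
include hb

omit [Fintype E] [DecidableEq E] in
/-- A core-free e-cube point with `u` in the hull is one-sided. -/
theorem CoreBaseE.oneSided_of_coreFree {ω : Config (Option ι)}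
    (hc : CoreFree ends (coreRealE ends A h u b ω) h)
    (hu : u ∈ hull ends (coreRealE ends A h u b ω) h) :
    (uRedE ends A u pure ω ∧ ¬ uRedE ends A u pure (flipAll ω)) ∨
      (¬ uRedE ends A u pure ω ∧ uRedE ends A u pure (flipAll ω)) := by
  have key : ∀ ω' : Config (Option ι), u ∈ redSetE ends A h u pure ω' → uRedE ends A u pure ω' := by
    intro ω' hu'
    rw [mem_redSetE_iff] at hu'
    rcases hu' with h1 | ⟨i, _, _, hi⟩ | ⟨h1, _⟩
    · exact absurd h1.symm hb.hne
    · exact absurd hi (hb.u_notMem_arm i)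
    · exact h1
  have hnot : ¬ (uRedE ends A u pure ω ∧ uRedE ends A u pure (flipAll ω)) := by
    rintro ⟨h1, h2⟩
    have hT := hb.u_mem_cluster_of_uRedE h1
    have hTp : u ∈ cluster ends (blue (coreRealE ends A h u b ω)) h := by
      rw [hb.blue_coreRealE]
      exact hb.dual.u_mem_cluster_of_uRedE h2
    exact hb.hne (hc u hT hTp).symm
  rcases hu with hu | hu
  · rw [hb.cluster_coreRealE] at hu
    exact Or.inl ⟨key ω hu, fun h2 => hnot ⟨key ω hu, h2⟩⟩
  · rw [hb.cluster_blue_coreRealE] at hu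
    exact Or.inr ⟨fun h1 => hnot ⟨h1, key _ hu⟩, key _ hu⟩

omit [Fintype E] [DecidableEq E] hb in
/-- The normalised one-sided point of a one-sided e-cube point: its arm coordinates when it is
red-one-sided (the h–u edge is then red), the toggled arm coordinates when it is blue-one-sided
(the h–u edge is then blue). -/
theorem exists_normalisedE {ω : Config (Option ι)}
    (hone : (uRedE ends A u pure ω ∧ ¬ uRedE ends A u pure (flipAll ω)) ∨
      (¬ uRedE ends A u pure ω ∧ uRedE ends A u pure (flipAll ω))) :
    ∃ ω₀ : Config ι, ¬ uRed ends A u pure (flipAll ω₀) ∧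
      ((ω none = true ∧ ∀ i, uAdjC ends u A i → ω (some i) = ω₀ i) ∨
        (ω none = false ∧ ∀ i, uAdjC ends u A i → ω (some i) = toggle (uAdjC ends u A) ω₀ i)) := by
  rcases hone with ⟨_, h2⟩ | ⟨h1, _⟩
  · have hn : ω none = true := by
      by_contra hn
      exact h2 (Or.inl (by simp [flipAll]; simpa using hn))
    refine ⟨ω ∘ some, fun hu => h2 (Or.inr (by rw [flipAll_comp_some]; exact hu)),
      Or.inl ⟨hn, fun _ _ => rfl⟩⟩
  · have hn : ω none = false := by
      by_contra hn
      exact h1 (Or.inl (by simpa using hn))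
    have hnr : ¬ uRed ends A u pure (ω ∘ some) := fun hu => h1 (Or.inr hu)
    refine ⟨toggle (uAdjC ends u A) (ω ∘ some), ?_, Or.inr ⟨hn, fun i _ => by rw [toggle_toggle]; rfl⟩⟩
    intro h3
    apply hnr
    refine (uRed_congr ?_).1 h3
    intro i hi
    simp only [flipAll, toggle_apply_of_pos hi, Bool.not_not]

omit [Fintype E] [DecidableEq E] in
/-- The extended hull of the base is `H`. -/
theorem CoreBaseE.extHull_base : extHull ends b h u = H := by
  have := hb.extHull_coreRealE (withHuRed fun _ => true)
  rwa [hb.coreRealE_withHuRed, CoreBase.coreReal_top] at this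

end OneSided

/-! ## The two orbit lemmas -/

section Orbits

variable (hl : l ∉ U) (hhu : h ≠ u) (hloop_h : ∀ e, ends e ≠ s(h, h))
  (hloop_u : ∀ e, ends e ≠ s(u, u)) (hadj : ∃ e, ends e = s(h, u))
  (hhu1 : ∀ e e', ends e = s(h, u) → ends e' = s(h, u) → e = e')
  (hout : ∀ x ∈ U, x ≠ h → x ≠ o → x ≠ u →
    (∃ e y, ends e = s(x, y) ∧ y ∉ U) ∨ (∀ e, x ∉ ends e))
  (hH1 : H1 ends U h u)
include hl hhu hloop_h hloop_u hadj hhu1 hout hH1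

/-- **The orbit through a sealed point**: an escaping `Q`-point of the coarse orbit of a core-free
core-kind `Q`-point is of the shadow kind. -/
theorem shadowKindE_of_mem_orbit_coreKind {ζ' : Config E} (hζ' : ζ' ∈ swOutSide ends l h o U ξ)
    (hk : CoreKind ends U h u ζ') (hc' : CoreFree ends ζ' h) {ζ : Config E}
    (hζ : ζ ∈ orbit ends (allRed ends ζ' h) h) (hQ : ζ ∈ tgtU ends l h {T : Set V | o ∈ T})
    (hesc : ¬ hull ends ζ u ⊆ U) : ShadowKindE ends U ξ h u ζ := by
  have hb : CoreBaseE ends (coreBaseOfE ends ζ' h u) h u (extHull ends ζ' h u)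
      (armsFun (armsC ends h u ζ')) (pureFun ends h (armsC ends h u ζ')) :=
    coreBaseE_of_coreKind hl hhu hloop_h hloop_u hadj hout hH1 hζ' hk
  have hHU := extHull_subset_of_coreKind hζ' hk
  have hrep : coreRealE ends (armsFun (armsC ends h u ζ')) h u (coreBaseOfE ends ζ' h u)
      (omegaOfE ends h u ζ') = ζ' := coreRealE_coreBaseOfE hl hhu hhu1 hout hζ' hk
  have hone := hb.oneSided_of_coreFree (ω := omegaOfE ends h u ζ') (by rw [hrep]; exact hc')
    (by rw [hrep]; exact hk.1)
  obtain ⟨ω₀, huB, hω⟩ := exists_normalisedE (A := armsFun (armsC ends h u ζ'))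
    (pure := pureFun ends h (armsC ends h u ζ')) hone
  have hconn : ArmsConnected (armsFun (armsC ends h u ζ')) ends := armsConnected_armsC ζ'
  rw [← hrep] at hζ
  rcases hb.mem_orbit_coreRealE_oneSided huB hconn hω hζ with ⟨ω'', hζeq⟩ | ⟨ω₁, hζeq⟩
  · -- `ζ` is a shadow point of the normalised point
    have hagree : ∀ i, uAdjC ends u (armsFun (armsC ends h u ζ')) i →
        ω₀ i = omegaSR (armsC ends h u ζ') (redSetOf ω₀ ends u) i :=
      fun i hi => omegaSR_redSetOf ω₀ i hi
    have hb' : CoreBaseE ends (coreBaseOfE ends ζ' h u) h u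
        (extHull ends (coreBaseOfE ends ζ' h u) h u)
        (armsFun (armsC ends h u ζ')) (pureFun ends h (armsC ends h u ζ')) := by
      rw [hb.extHull_base]; exact hb
    by_cases hZ : ∃ P : armsC ends h u ζ', uAdjC ends u (armsFun (armsC ends h u ζ')) P ∧ ω₀ P = false
    · have hζblk : ζ ∈ shadowBlock ends u (coreBaseOfE ends ζ' h u) (armsC ends h u ζ')
          (redSetOf ω₀ ends u) := by
        rw [mem_shadowBlock_iff]
        refine ⟨ω'', ?_⟩
        rw [hζeq, sB_congr hagree, sZ_congr hagree, shadowOf_congr hagree]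
      have hd : ShadowDataE ends U ξ h u (coreBaseOfE ends ζ' h u) (armsC ends h u ζ')
          (redSetOf ω₀ ends u) :=
        { hS := (armsC_eq_of_extHull_eq (hb.extHull_base)).symm
          hb := hb'
          hHU := by rw [hb.extHull_base]; exact hHU
          hbcl := coreBaseOfE_mem_outClass (mem_swOutSide.1 hζ').2 hk hb
          huB := fun h' => huB ((uRed_congr (flipAll_congr hagree)).2 h')
          hZ := by
            obtain ⟨P, hP, hωP⟩ := hZ
            exact ⟨P, hP, by rw [← hagree P hP]; exact hωP⟩
          hR := redSetOf_canon ω₀ }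
      exact (shadowKindE_of_mem_shadowBlock hl hout hd hζblk hQ).2.2.2.1
    · -- no dropped arm: `ζ` is a core point, not escaping
      exfalso
      have hZ' : ∀ i, uAdjC ends u (armsFun (armsC ends h u ζ')) i → ω₀ i = true := by
        intro i hi
        by_contra hne
        exact hZ ⟨i, hi, by simpa using hne⟩
      obtain ⟨ω₁, hω₁⟩ := hb.shadowReal_eq_coreRealE_of_no_drop hZ' ω''
      apply hesc
      rw [hζeq, hω₁]
      exact (hb.hull_u_coreRealE_subset ω₁).trans hHU
  · exfalso
    apply hesc
    rw [hζeq]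
    exact (hb.hull_u_coreRealE_subset ω₁).trans hHU

omit hhu hloop_h hloop_u hadj hhu1 hH1 in
/-- **The orbit through a shadow point**: an escaping `Q`-point of the coarse orbit of a
shadow-kind point is of the shadow kind. -/
theorem shadowKindE_of_mem_orbit_shadowKind {ζ' : Config E} (hsk : ShadowKindE ends U ξ h u ζ')
    {ζ : Config E} (hζ : ζ ∈ orbit ends (allRed ends ζ' h) h)
    (hQ : ζ ∈ tgtU ends l h {T : Set V | o ∈ T}) (hesc : ¬ hull ends ζ u ⊆ U) :
    ShadowKindE ends U ξ h u ζ := by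
  obtain ⟨hd, hblk⟩ := hsk
  have hconn : ArmsConnected (armsFun (armsOf ends h u ζ')) ends := by
    rw [hd.hS]; exact armsConnected_armsC _
  obtain ⟨ω'', hζ'eq⟩ := (mem_shadowBlock_iff).1 hblk
  rw [← hζ'eq] at hζ
  rcases hd.hb.mem_orbit_shadowReal hd.huB hconn ω'' hζ with ⟨ω''', hζeq⟩ | ⟨ω₁, hζeq⟩
  · have hζblk : ζ ∈ shadowBlock ends u (baseOfE ends h u ζ') (armsOf ends h u ζ')
        (redOf ends h u ζ') := (mem_shadowBlock_iff).2 ⟨ω''', hζeq.symm⟩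
    exact (shadowKindE_of_mem_shadowBlock hl hout hd hζblk hQ).2.2.2.1
  · exfalso
    apply hesc
    rw [hζeq]
    exact (hd.hb.hull_u_coreRealE_subset ω₁).trans hd.hHU

/-- **A `Q`-point of the orbit of an escaping point of the plain kind is escaping of the plain
kind** (and lies in the class). -/
theorem mem_orbit_plainE {ζ : Config E} (hζ : ζ ∈ swOutSide ends l h o U ξ)
    (hu : u ∈ hull ends ζ h) (hesc : ¬ hull ends ζ u ⊆ U) (hns : ¬ ShadowKindE ends U ξ h u ζ)
    {ζ' : Config E} (hζ' : ζ' ∈ orbit ends (allRed ends ζ h) h)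
    (hQ : ζ' ∈ tgtU ends l h {T : Set V | o ∈ T}) :
    ζ' ∈ swOutSide ends l h o U ξ ∧ u ∈ hull ends ζ' h ∧ ¬ hull ends ζ' u ⊆ U ∧
      ¬ ShadowKindE ends U ξ h u ζ' := by
  have hc : CoreFree ends ζ h := coreFree_of_escaping hout hζ hesc
  have hc₀ : CoreFree ends (allRed ends ζ h) h := coreFree_allRed hc
  have hcl₀ : allRed ends ζ h ∈ outClass ends U h ξ :=
    allRed_mem_outClass (mem_swOutSide.1 hζ).2 hc
  have hmem := hζ'
  simp only [orbit, Finset.mem_image, Finset.mem_univ, true_and] at hmem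
  obtain ⟨ω', rfl⟩ := hmem
  have hζ'cl : orbitReal ends (allRed ends ζ h) h ω' ∈ swOutSide ends l h o U ξ :=
    mem_swOutSide.2 ⟨hQ, orbitReal_mem_outClass hc₀ hcl₀ ω'⟩
  have hu' : u ∈ hull ends (orbitReal ends (allRed ends ζ h) h ω') h := by
    rw [hull_orbitReal hc₀, hull_allRed hc]; exact hu
  have hc' : CoreFree ends (orbitReal ends (allRed ends ζ h) h ω') h := coreFree_orbitReal hc₀ ω'
  have hζorb : ζ ∈ orbit ends (allRed ends (orbitReal ends (allRed ends ζ h) h ω') h) h := by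
    rw [allRed_orbitReal hc₀, allRed_idem hc]
    obtain ⟨ω, hω⟩ := exists_orbitReal_eq (ζ₀ := allRed ends ζ h) hc rfl
    simp only [orbit, Finset.mem_image, Finset.mem_univ, true_and]
    exact ⟨ω, hω⟩
  have hQζ : ζ ∈ tgtU ends l h {T : Set V | o ∈ T} := (mem_swOutSide.1 hζ).1
  refine ⟨hζ'cl, hu', fun hsub => ?_, fun hsk => ?_⟩
  · exact hns (shadowKindE_of_mem_orbit_coreKind hl hhu hloop_h hloop_u hadj hhu1 hout hH1 hζ'cl
      ⟨hu', hsub⟩ hc' hζorb hQζ hesc)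
  · exact hns (shadowKindE_of_mem_orbit_shadowKind hl hout hsk hζorb hQζ hesc)

end Orbits

end LocRows

end Summit.Ventures.PercRepro2
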